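import Literature.Probability.Percolation.IntTermFence
import Literature.Probability.Percolation.IntFrameBelow
import Literature.Probability.Percolation.ArmSeparationInner
import HarnessLib

/-!
# Exits of arms through inner fences (twin of the structures of `TrapFencedExit.lean`)

Topic `Literature/Probability/Percolation`; family `crit-perc` / near-critical percolation on `𝕋`.
A brick of the INNER half of the near-critical arm-separation theorem for four arms in the ADJACENT
colour arrangement (P. Nolin, EJP 13 (2008), Thm. 11, `j = 4`, `σ = BBWW` [arXiv 0711.4948:
Thm. 10], §4.2 Def. 6–8 and §4.4, internal extremities). The data produced by the inner pair
surgery and consumed by the inner landing: an arm of a region `A` outside `Λ_m` (abstract, as in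
`IntFencedArm`; it will carry the outer landing structure) rerouted from its far end `b`
(`|b| > 2m`) through the fence of a term INTO `Λ_m`, ending on an open vertical crossing of the
corner box `[z₀-2k, z₀-k] × [z₁+k, z₁+2k]` of a nominal tip `z` of the inner side:

* `intExitZone m z k` — the square of half-width `2k + 1` about `z` extended by `4k` rows upwards,
  in the half-annulus or inside `Λ_m` (it contains `intFrameZone m z k`, and the connection of a
  fence from above with tip `z + 3k e₁`);
* `IntFencedExit m A k₀ K χ` (route in `A ∪ intFrameZone`) and `IntExit m A k₀ K χ` (route in
  `A ∪ intExitZone`); `restrict` (monotonicity under restriction of the configuration to a set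
  containing the route and the corner box), `IntFencedExit.toIntExit`, `IntFencedArm.toExit`.

Everything here is proved; no named facts are introduced.

## References

* P. Nolin, Near-critical percolation in two dimensions, *Electron. J. Probab.* 13 (2008), §4.2
  Def. 6–8, §4.4 Lemma 15, internal extremities (arXiv 0711.4948: Def. 6–8, Lemma 14) [Nolin2008].
-/

noncomputable section

open Set

namespace Literature.Probability.Percolation

open LatticeModels HalfAnnulus

/-- **The zone of an inner exit**: the square of half-width `2k + 1` about the nominal tip `z`,
extended by `4k` rows upwards, in the half-annulus or inside `Λ_m`. [folklore] -/
def intExitZone (m : ℕ) (z : Site 2) (k : ℕ) : Set (Site 2) :=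
  {v | (v ∈ haSet m ∨ v ∈ hinSet m) ∧
    z 0 - (2 * k + 1) ≤ v 0 ∧ v 0 ≤ z 0 + (2 * k + 1) ∧ z 1 - (2 * k + 1) ≤ v 1 ∧ v 1 ≤ z 1 + (6 * k + 1)}

/-- Membership in the zone of an inner exit, unfolded. [folklore] -/
theorem mem_intExitZone {m k : ℕ} {z v : Site 2} :
    v ∈ intExitZone m z k ↔ (v ∈ haSet m ∨ v ∈ hinSet m) ∧
      z 0 - (2 * k + 1) ≤ v 0 ∧ v 0 ≤ z 0 + (2 * k + 1) ∧ z 1 - (2 * k + 1) ≤ v 1 ∧ v 1 ≤ z 1 + (6 * k + 1) :=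
  Iff.rfl

/-- The inner fence zone lies in the zone of the exit with the same tip. [folklore] -/
theorem intFrameZone_subset_intExitZone {m k : ℕ} {z : Site 2} : intFrameZone m z k ⊆ intExitZone m z k := by
  intro v hv
  rw [mem_intFrameZone] at hv
  refine ⟨hv.1.imp_right fun h => h.1, hv.2.1, hv.2.2.1, hv.2.2.2.1, ?_⟩
  have := hv.2.2.2.2
  have hk : (0 : ℤ) ≤ k := by positivity
  omega

/-- The mirrored inner fence zone of the tip `z⁺ = z + 3k e₁` lies in the zone of the exit with
nominal tip `z`. [folklore] -/
theorem intFrameZoneBelow_subset_intExitZone {m k : ℕ} {z z' : Site 2} (hz0 : z' 0 = z 0) (hz1 : z' 1 = z 1 + 3 * k) :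
    intFrameZoneBelow m z' k ⊆ intExitZone m z k := by
  intro v hv
  rw [mem_intFrameZoneBelow] at hv
  refine ⟨hv.1.imp_right fun h => h.1, by omega, by omega, by omega, by omega⟩

/-- Monotonicity of the region of the routes. [folklore] -/
theorem intExitRegion_mono {m k : ℕ} {A : Set (Site 2)} {z : Site 2} {χ : SiteConfig (Site 2)} :
    (A ∪ intFrameZone m z k) ∩ (χ : Set (Site 2)) ⊆ (A ∪ intExitZone m z k) ∩ χ :=
  Set.inter_subset_inter_left _ (Set.union_subset_union_right _ intFrameZone_subset_intExitZone)

/-- **A fenced inner exit** of the region `A` in the configuration `χ`: a tip `z` of the inner side,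
a scale `k = k₀ · 32^j`, an open vertical crossing of the corner box `[z₀-2k, z₀-k] × [z₁+k, z₁+2k]`
inside `Λ_m` through `m'`, and an open route from a far end `b` (`|b| > 2m`) to `m'` inside
`A ∪ intFrameZone m z k`. [cite: Nolin2008, §4.2 Def. 6–8 and §4.4, internal extremities (arXiv 0711.4948: Def. 6–8, Lemma 14)] -/
structure IntFencedExit (m : ℕ) (A : Set (Site 2)) (k₀ K : ℕ) (χ : SiteConfig (Site 2)) where
  /-- the tip -/
  z : Site 2
  /-- the scale index -/
  j : ℕ
  /-- the site of the fence through which the vertical crossing passes -/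
  m' : Site 2
  /-- the far end of the route -/
  b : Site 2
  z_isIntJ : IsIntJ m z
  j_lt : j < K
  b_far : 2 * (m : ℤ) < triNorm b
  vcross : OpenVCrossThrough (triStrip (z 0 - 2 * trapScale k₀ j) (z 1 + trapScale k₀ j) (trapScale k₀ j) (trapScale k₀ j))
    (z 1 + trapScale k₀ j) (z 1 + 2 * trapScale k₀ j) χ m'
  path : PathIn triGraph ((A ∪ intFrameZone m z (trapScale k₀ j)) ∩ χ) b m'

namespace IntFencedExit

variable {m k₀ K : ℕ} {A : Set (Site 2)} {χ : SiteConfig (Site 2)}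

/-- The scale of a fenced exit. [folklore] -/
def k (F : IntFencedExit m A k₀ K χ) : ℕ := trapScale k₀ F.j

/-- **Restriction.** [folklore] -/
def restrict (F : IntFencedExit m A k₀ K χ) {S P : Set (Site 2)} (hP : PathIn triGraph S F.b F.m')
    (hS : S ⊆ (A ∪ intFrameZone m F.z F.k) ∩ χ) (hSP : S ⊆ P)
    (hbox : triStrip (F.z 0 - 2 * F.k) (F.z 1 + F.k) F.k F.k ⊆ P) : IntFencedExit m A k₀ K (χ ∩ P) where
  z := F.z
  j := F.j
  m' := F.m'
  b := F.b
  z_isIntJ := F.z_isIntJ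
  j_lt := F.j_lt
  b_far := F.b_far
  vcross := by
    obtain ⟨b, t, hb, ht, Pb, Pt⟩ := F.vcross
    exact ⟨b, t, hb, ht, Pb.mono fun v hv => ⟨hv.1, hv.2, hbox hv.1⟩, Pt.mono fun v hv => ⟨hv.1, hv.2, hbox hv.1⟩⟩
  path := hP.mono fun v hv => ⟨(hS hv).1, (hS hv).2, hSP hv⟩

/-- Restriction keeps the tip. [folklore] -/
@[simp] theorem restrict_z (F : IntFencedExit m A k₀ K χ) {S P : Set (Site 2)} (hP : PathIn triGraph S F.b F.m')
    (hS : S ⊆ (A ∪ intFrameZone m F.z F.k) ∩ χ) (hSP : S ⊆ P)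
    (hbox : triStrip (F.z 0 - 2 * F.k) (F.z 1 + F.k) F.k F.k ⊆ P) : (F.restrict hP hS hSP hbox).z = F.z := rfl

/-- Restriction keeps the scale. [folklore] -/
@[simp] theorem restrict_k (F : IntFencedExit m A k₀ K χ) {S P : Set (Site 2)} (hP : PathIn triGraph S F.b F.m')
    (hS : S ⊆ (A ∪ intFrameZone m F.z F.k) ∩ χ) (hSP : S ⊆ P)
    (hbox : triStrip (F.z 0 - 2 * F.k) (F.z 1 + F.k) F.k F.k ⊆ P) : (F.restrict hP hS hSP hbox).k = F.k := rfl

/-- Restriction keeps the far end. [folklore] -/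
@[simp] theorem restrict_b (F : IntFencedExit m A k₀ K χ) {S P : Set (Site 2)} (hP : PathIn triGraph S F.b F.m')
    (hS : S ⊆ (A ∪ intFrameZone m F.z F.k) ∩ χ) (hSP : S ⊆ P)
    (hbox : triStrip (F.z 0 - 2 * F.k) (F.z 1 + F.k) F.k F.k ⊆ P) : (F.restrict hP hS hSP hbox).b = F.b := rfl

end IntFencedExit

/-- A fenced inner arm is a fenced inner exit. [folklore] -/
def IntFencedArm.toExit {m k₀ K R₀ : ℕ} {A : Set (Site 2)} {χ : SiteConfig (Site 2)} (F : IntFencedArm m A k₀ K R₀ χ) :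
    IntFencedExit m A k₀ K χ :=
  ⟨F.z, F.j, F.mm, F.b, F.z_isIntJ, F.j_lt, F.b_far, F.tipOK.1, F.path⟩

/-- `toExit` keeps the scale. [folklore] -/
@[simp] theorem IntFencedArm.toExit_k {m k₀ K R₀ : ℕ} {A : Set (Site 2)} {χ : SiteConfig (Site 2)} (F : IntFencedArm m A k₀ K R₀ χ) :
    F.toExit.k = F.k := rfl

/-! ### Exits with the wide zone -/

/-- **An inner exit** (the general form): as `IntFencedExit`, the route being allowed in the wider
zone `intExitZone` of the nominal tip — so that a fence FROM ABOVE (`IntTermFenceUp`, corner box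
below its tip `z⁺`) is an exit with nominal tip `z = z⁺ - 3k e₁`. [cite: Nolin2008, §4.2 Def. 6–8 and §4.4, internal extremities (arXiv 0711.4948: Def. 6–8, Lemma 14)] -/
structure IntExit (m : ℕ) (A : Set (Site 2)) (k₀ K : ℕ) (χ : SiteConfig (Site 2)) where
  /-- the nominal tip -/
  z : Site 2
  /-- the scale index -/
  j : ℕ
  /-- the site of the fence through which the vertical crossing passes -/
  m' : Site 2
  /-- the far end of the route -/
  b : Site 2
  z_isIntJ : IsIntJ m z
  j_lt : j < K
  b_far : 2 * (m : ℤ) < triNorm b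
  vcross : OpenVCrossThrough (triStrip (z 0 - 2 * trapScale k₀ j) (z 1 + trapScale k₀ j) (trapScale k₀ j) (trapScale k₀ j))
    (z 1 + trapScale k₀ j) (z 1 + 2 * trapScale k₀ j) χ m'
  path : PathIn triGraph ((A ∪ intExitZone m z (trapScale k₀ j)) ∩ χ) b m'

namespace IntExit

variable {m k₀ K : ℕ} {A : Set (Site 2)} {χ : SiteConfig (Site 2)}

/-- The scale of an exit. [folklore] -/
def k (F : IntExit m A k₀ K χ) : ℕ := trapScale k₀ F.j

/-- **Restriction.** [folklore] -/
def restrict (F : IntExit m A k₀ K χ) {S P : Set (Site 2)} (hP : PathIn triGraph S F.b F.m')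
    (hS : S ⊆ (A ∪ intExitZone m F.z F.k) ∩ χ) (hSP : S ⊆ P)
    (hbox : triStrip (F.z 0 - 2 * F.k) (F.z 1 + F.k) F.k F.k ⊆ P) : IntExit m A k₀ K (χ ∩ P) where
  z := F.z
  j := F.j
  m' := F.m'
  b := F.b
  z_isIntJ := F.z_isIntJ
  j_lt := F.j_lt
  b_far := F.b_far
  vcross := by
    obtain ⟨b, t, hb, ht, Pb, Pt⟩ := F.vcross
    exact ⟨b, t, hb, ht, Pb.mono fun v hv => ⟨hv.1, hv.2, hbox hv.1⟩, Pt.mono fun v hv => ⟨hv.1, hv.2, hbox hv.1⟩⟩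
  path := hP.mono fun v hv => ⟨(hS hv).1, (hS hv).2, hSP hv⟩

/-- Restriction keeps the tip. [folklore] -/
@[simp] theorem restrict_z (F : IntExit m A k₀ K χ) {S P : Set (Site 2)} (hP : PathIn triGraph S F.b F.m')
    (hS : S ⊆ (A ∪ intExitZone m F.z F.k) ∩ χ) (hSP : S ⊆ P)
    (hbox : triStrip (F.z 0 - 2 * F.k) (F.z 1 + F.k) F.k F.k ⊆ P) : (F.restrict hP hS hSP hbox).z = F.z := rfl

/-- Restriction keeps the scale. [folklore] -/
@[simp] theorem restrict_k (F : IntExit m A k₀ K χ) {S P : Set (Site 2)} (hP : PathIn triGraph S F.b F.m')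
    (hS : S ⊆ (A ∪ intExitZone m F.z F.k) ∩ χ) (hSP : S ⊆ P)
    (hbox : triStrip (F.z 0 - 2 * F.k) (F.z 1 + F.k) F.k F.k ⊆ P) : (F.restrict hP hS hSP hbox).k = F.k := rfl

/-- Restriction keeps the far end. [folklore] -/
@[simp] theorem restrict_b (F : IntExit m A k₀ K χ) {S P : Set (Site 2)} (hP : PathIn triGraph S F.b F.m')
    (hS : S ⊆ (A ∪ intExitZone m F.z F.k) ∩ χ) (hSP : S ⊆ P)
    (hbox : triStrip (F.z 0 - 2 * F.k) (F.z 1 + F.k) F.k F.k ⊆ P) : (F.restrict hP hS hSP hbox).b = F.b := rfl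

/-- The fence site of an exit is inside `Λ_m` (middle tip). [folklore] -/
theorem norm_m' (F : IntExit m A k₀ K χ) (hk : 1 ≤ F.k) (htk : -(m : ℤ) + 2 * F.k + 1 ≤ F.z 1 ∧ F.z 1 ≤ -(2 * (F.k : ℤ) + 1)) :
    triNorm F.m' < m := by
  obtain ⟨e₁, e₂, -, -, hp, -⟩ := F.vcross
  have hm := (hp.right_mem).1
  rw [mem_triStrip] at hm
  obtain ⟨hz0, hz1, hz2⟩ := F.z_isIntJ
  have hk' : (1 : ℤ) ≤ F.k := by exact_mod_cast hk
  change F.z 0 - 2 * (F.k : ℤ) ≤ F.m' 0 ∧ F.m' 0 ≤ F.z 0 - 2 * (F.k : ℤ) + F.k ∧ F.z 1 + F.k ≤ F.m' 1 ∧ F.m' 1 ≤ F.z 1 + F.k + F.k at hm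
  rw [triNorm_eq_max]; omega

end IntExit

/-- A fenced inner exit is an inner exit. [folklore] -/
def IntFencedExit.toIntExit {m k₀ K : ℕ} {A : Set (Site 2)} {χ : SiteConfig (Site 2)} (F : IntFencedExit m A k₀ K χ) : IntExit m A k₀ K χ :=
  ⟨F.z, F.j, F.m', F.b, F.z_isIntJ, F.j_lt, F.b_far, F.vcross, F.path.mono intExitRegion_mono⟩

/-- `toIntExit` keeps the tip. [folklore] -/
@[simp] theorem IntFencedExit.toIntExit_z {m k₀ K : ℕ} {A : Set (Site 2)} {χ : SiteConfig (Site 2)} (F : IntFencedExit m A k₀ K χ) :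
    F.toIntExit.z = F.z := rfl

/-- `toIntExit` keeps the scale. [folklore] -/
@[simp] theorem IntFencedExit.toIntExit_k {m k₀ K : ℕ} {A : Set (Site 2)} {χ : SiteConfig (Site 2)} (F : IntFencedExit m A k₀ K χ) :
    F.toIntExit.k = F.k := rfl

/-- `toIntExit` keeps the far end. [folklore] -/
@[simp] theorem IntFencedExit.toIntExit_b {m k₀ K : ℕ} {A : Set (Site 2)} {χ : SiteConfig (Site 2)} (F : IntFencedExit m A k₀ K χ) :
    F.toIntExit.b = F.b := rfl

/-- `toIntExit` keeps the fence site. [folklore] -/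
@[simp] theorem IntFencedExit.toIntExit_m' {m k₀ K : ℕ} {A : Set (Site 2)} {χ : SiteConfig (Site 2)} (F : IntFencedExit m A k₀ K χ) :
    F.toIntExit.m' = F.m' := rfl

end Literature.Probability.Percolation
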